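import Literature.Topology.FourManifolds.RegularLevelSet
import Literature.Topology.FourManifolds.TrisectionsRadialThickening
import HarnessLib

/-!
# Morse data of a function restricted to a regular level, read in an ambient chart

Topic `Literature/Topology/FourManifolds`; infrastructure for the fact seat
`provefact-Literature.Topology.FourManifolds.exists_isBalancedGKTrisection` (Gay–Kirby 2016,
Thm. 4 via §4, Lemma 14).  Everything in this file is **proved**; no definitions, no named
facts.

A Morse-theoretic construction of Gay–Kirby's trisection works with functions on the closed
`3`-manifold `Y = f⁻¹(c) = ∂X₁` (the Heegaard function) and on the `3`-manifold
`H₂₃ = {G = 0}` that are **restrictions of explicit smooth functions `F` on the `4`-manifold**,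
whose critical points and indices must be read off the ambient formulas.  This file supplies
the dictionary for the tree's regular levels (`Literature.Topology.FourManifolds.RegularLevel`,
built from slice charts, `SliceCharts.lean`, Lee 2013, Thm. 5.8; Hirsch 1976, Ch. 1 §3,
Thm. 3.2), over the boundaryless Euclidean model:

* `SliceChartFamily.writtenInExtChartAt_comp_val_eventuallyEq` — in the level chart at `p`,
  `F ∘ ι` reads `(F ∘ ψₚ⁻¹) ∘ (u ↦ (u, 0))`, `ψₚ` the slice chart;
* `SliceChartFamily.isMCriticalPt_comp_val_iff`, `SliceChartFamily.mhessian_comp_val_apply` —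
  `p` is critical for `F|S` iff `D(F ∘ ψₚ⁻¹)(ψₚ p)` vanishes on the slice hyperplane
  `{u_{last} = 0}`, and the Hessian of `F|S` at `p` is `D²(F ∘ ψₚ⁻¹)(ψₚ p)` restricted to that
  hyperplane (second-order chain rule through the linear map `u ↦ (u, 0)`,
  `fderiv_fderiv_comp_clm_apply`);
* `RegularLevel.isMCriticalPt_comp_incl_iff_of_chart`, `RegularLevel.mhessian_comp_incl_apply_of_chart`,
  `RegularLevel.nondegenerate_mhessian_comp_incl_iff`, `RegularLevel.morseIndex_comp_incl_eq` —
  **for a regular level `Y = f⁻¹(a)` and any chart `e` of the maximal atlas at `p`**: `p` is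
  critical for `F|Y` iff `D(F ∘ e⁻¹)(e p)` vanishes on `V = ker D(f ∘ e⁻¹)(e p)` (the tangent
  hyperplane of the level read in `e`); and **at an ambient critical point of `F`** the
  Hessian of `F|Y` is congruent to the restriction to `V` of `D²(F ∘ e⁻¹)(e p)`, so that
  nondegeneracy and the Morse index of `F|Y` at `p` are those of that restricted form
  (Milnor 1963, §2: the Hessian at a critical point is intrinsic; Sylvester).  This is how the
  critical points `p_j`, `q_j` of the Heegaard function on the tubes about the attaching link,
  and later the critical points of the handlebody `H₂₃`, are certified nondegenerate of the
  right index from explicit `4`-dimensional formulas.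

## References

* J. Milnor, *Morse theory* (1963), §2. [Milnor1963]
* J. M. Lee, *Introduction to Smooth Manifolds* (2013), Thm. 5.8, Prop. 5.38 (tangent space to
  a level set is the kernel of the differential). [LeeSmoothManifolds2013]
* D. Gay, R. Kirby, *Trisecting 4-manifolds*, Geom. Topol. 20 (2016), §4, Lemma 14.
  [GayKirby2016]
-/

open scoped Manifold ContDiff Topology
open Set Function Filter

noncomputable section

universe u

namespace Literature.Topology.FourManifolds

/-- Local notation: `𝔼 n` is the model Euclidean space `EuclideanSpace ℝ (Fin n)`. -/
local notation "𝔼 " n:arg => EuclideanSpace ℝ (Fin n)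

/-- The **slice embedding** `u ↦ (u, 0)` of the model hyperplane, as a continuous linear map
`ℝⁿ → ℝⁿ⁺¹` (last coordinate `0`). [folklore] -/
abbrev sliceInl (n : ℕ) : 𝔼 n →L[ℝ] 𝔼 (n + 1) :=
  (snocEquiv n : (𝔼 n × ℝ) →L[ℝ] 𝔼 (n + 1)).comp (ContinuousLinearMap.inl ℝ (𝔼 n) ℝ)

/-- `sliceInl n u = snocEquiv n (u, 0)` (definitional). [folklore] -/
@[simp] theorem sliceInl_apply (n : ℕ) (u : 𝔼 n) : sliceInl n u = snocEquiv n (u, 0) := rfl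

/-- The slice embedding is injective. [folklore] -/
theorem sliceInl_injective (n : ℕ) : Injective (sliceInl n) := by
  intro u u' h
  have := congrArg (fun y => ((snocEquiv n).symm y).1) h
  simpa using this

/-- The last coordinate of `sliceInl n u` vanishes. [folklore] -/
theorem sliceInl_apply_last (n : ℕ) (u : 𝔼 n) : sliceInl n u (Fin.last n) = 0 := by
  simp [snocEquiv_apply_last]

namespace SliceChartFamily

variable {n : ℕ} {M : Type u} [TopologicalSpace M] [ChartedSpace (𝔼 (n + 1)) M]
  {S : Set M} (Ψ : SliceChartFamily (𝓡 (n + 1)) S)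

/-- The base point of the level chart at `p`, pushed back into `ℝⁿ⁺¹` by the slice embedding,
is the slice chart of `p`. [folklore] -/
theorem sliceInl_extChartAt (p : S) :
    letI := Ψ.chartedSpace
    sliceInl n (extChartAt (𝓡 n) p p) = Ψ.chart p p.1 := by
  letI := Ψ.chartedSpace
  have h := Ψ.snocEquiv_levelChart (p := p) (q := p) (by
    rw [levelChart_source]; exact Ψ.mem_source p)
  simp only [modelWithCornersSelf_coe, id_eq] at h
  rw [sliceInl_apply, extChartAt, Ψ.chartAt_eq]
  simpa using h

/-- The target of the level chart is a neighbourhood of the base point. [folklore] -/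
theorem levelChart_target_mem_nhds (p : S) :
    letI := Ψ.chartedSpace
    (Ψ.levelChart p).target ∈ 𝓝 (extChartAt (𝓡 n) p p) := by
  letI := Ψ.chartedSpace
  have h1 : (Ψ.levelChart p) p ∈ (Ψ.levelChart p).target :=
    (Ψ.levelChart p).map_source (by rw [levelChart_source]; exact Ψ.mem_source p)
  have h2 : extChartAt (𝓡 n) p p = Ψ.levelChart p p := by
    rw [extChartAt, Ψ.chartAt_eq]; simp
  rw [h2]
  exact (Ψ.levelChart p).open_target.mem_nhds h1

/-- **A function on the slice subset read in the level chart**: near the base point,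
`F ∘ ι` written in the preferred extended chart at `p` is `(F ∘ ψₚ⁻¹) ∘ sliceInl`, `ψₚ` the
slice chart of `M` at `p`. [cite: LeeSmoothManifolds2013, Thm. 5.8] -/
theorem writtenInExtChartAt_comp_val_eventuallyEq (F : M → ℝ) (p : S) :
    letI := Ψ.chartedSpace
    writtenInExtChartAt (𝓡 n) 𝓘(ℝ, ℝ) p (F ∘ Subtype.val) =ᶠ[𝓝 (extChartAt (𝓡 n) p p)]
      (F ∘ (Ψ.chart p).symm) ∘ sliceInl n := by
  letI := Ψ.chartedSpace
  filter_upwards [Ψ.levelChart_target_mem_nhds p] with u hu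
  have h := Ψ.coe_levelChart_symm_of_mem hu
  simp only [modelWithCornersSelf_coe_symm, id_eq] at h
  simp only [writtenInExtChartAt, extChartAt, Ψ.chartAt_eq, Function.comp_apply,
    OpenPartialHomeomorph.extend_coe_symm, modelWithCornersSelf_coe_symm, id_eq,
    sliceInl_apply]
  simp [h]

/-- `F ∘ ψₚ⁻¹` is `C²` at `ψₚ p` when `F` is `C²` at `p`. [folklore] -/
theorem contDiffAt_comp_chart_symm {F : M → ℝ} {p : S} (hF : ContMDiffAt (𝓡 (n + 1)) 𝓘(ℝ, ℝ) 2 F p.1) :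
    ContDiffAt ℝ 2 (F ∘ (Ψ.chart p).symm) (Ψ.chart p p.1) := by
  have he : Ψ.chart p ∈ IsManifold.maximalAtlas (𝓡 (n + 1)) 2 M :=
    IsManifold.maximalAtlas_subset_of_le (by norm_cast) (Ψ.mem_maximalAtlas p)
  have h := contDiffAt_comp_extend_symm hF he (Ψ.mem_source p)
  simpa [OpenPartialHomeomorph.extend_coe, OpenPartialHomeomorph.extend_coe_symm] using h

/-- **The Hessian of `F|S` in the slice chart**: for `F` of class `C²` at `p ∈ S`,
`Hess(F|S)_p(v, w) = D²(F ∘ ψₚ⁻¹)(ψₚ p)((v, 0), (w, 0))` — the Hessian of the tree's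
`Literature.Topology.FourManifolds.mhessian` on `S` (preferred level chart at `p`) is the
second derivative of `F` read in the slice chart, restricted to the slice hyperplane
(second-order chain rule through the linear slice embedding). [cite: Milnor1963, §2] -/
theorem mhessian_comp_val_apply {F : M → ℝ} {p : S} (hF : ContMDiffAt (𝓡 (n + 1)) 𝓘(ℝ, ℝ) 2 F p.1)
    (v w : 𝔼 n) :
    letI := Ψ.chartedSpace
    mhessian (𝓡 n) (F ∘ Subtype.val) p v w =
      fderiv ℝ (fderiv ℝ (F ∘ (Ψ.chart p).symm)) (Ψ.chart p p.1) (sliceInl n v) (sliceInl n w) := by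
  letI := Ψ.chartedSpace
  have hev := Ψ.writtenInExtChartAt_comp_val_eventuallyEq F p
  have hF' := Ψ.contDiffAt_comp_chart_symm hF
  rw [mhessian]
  simp only [LinearMap.coe_comp, Function.comp_apply, ContinuousLinearMap.coe_coe,
    ContinuousLinearMap.coeLM_apply, ModelWithCorners.Boundaryless.range_eq_univ,
    fderivWithin_univ]
  rw [hev.fderiv.fderiv_eq, ← Ψ.sliceInl_extChartAt p]
  rw [← Ψ.sliceInl_extChartAt p] at hF'
  rw [fderiv_fderiv_comp_clm_apply (sliceInl n) hF' v w]

/-- **Critical points of `F|S` in the slice chart**: for `F` of class `C¹` at `p ∈ S`, `p` is a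
critical point of `F|S` iff `D(F ∘ ψₚ⁻¹)(ψₚ p)` vanishes on the slice hyperplane, i.e.
`D(F ∘ ψₚ⁻¹)(ψₚ p) ∘ sliceInl = 0`. [cite: LeeSmoothManifolds2013, Prop. 5.38] -/
theorem isMCriticalPt_comp_val_iff [IsManifold (𝓡 (n + 1)) ∞ M] {F : M → ℝ} {p : S}
    (hF : ContMDiffAt (𝓡 (n + 1)) 𝓘(ℝ, ℝ) 2 F p.1) :
    letI := Ψ.chartedSpace
    IsMCriticalPt (𝓡 n) (F ∘ Subtype.val) p ↔
      (fderiv ℝ (F ∘ (Ψ.chart p).symm) (Ψ.chart p p.1)).comp (sliceInl n) = 0 := by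
  letI := Ψ.chartedSpace
  haveI := Ψ.isManifold
  have hev := Ψ.writtenInExtChartAt_comp_val_eventuallyEq F p
  have hF' := Ψ.contDiffAt_comp_chart_symm hF
  have hval : ContMDiff (𝓡 n) (𝓡 (n + 1)) ∞ (Subtype.val : S → M) := Ψ.contMDiff_subtype_val
  have hd : MDifferentiableAt (𝓡 n) 𝓘(ℝ, ℝ) (F ∘ Subtype.val) p :=
    (hF.comp p ((hval p).of_le (by norm_cast))).mdifferentiableAt (by norm_num)
  rw [isMCriticalPt_iff_fderivWithin_writtenInExtChartAt_eq_zero (mem_extChartAt_source p) hd,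
    ModelWithCorners.Boundaryless.range_eq_univ, fderivWithin_univ, hev.fderiv_eq]
  have hpt : sliceInl n (extChartAt (𝓡 n) p p) = Ψ.chart p p.1 := Ψ.sliceInl_extChartAt p
  have hdiff : DifferentiableAt ℝ (F ∘ (Ψ.chart p).symm) (sliceInl n (extChartAt (𝓡 n) p p)) := by
    rw [hpt]; exact hF'.differentiableAt (by norm_num)
  rw [fderiv_comp _ hdiff (sliceInl n).differentiableAt, ContinuousLinearMap.fderiv, hpt]

end SliceChartFamily

/-! ### Regular levels: the same data in an arbitrary ambient chart -/

namespace RegularLevel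

variable {n : ℕ} {M : Type u} [TopologicalSpace M] [ChartedSpace (𝔼 (n + 1)) M]
  [IsManifold (𝓡 (n + 1)) ∞ M] {f : M → ℝ} {a : ℝ} (h : IsRegularLevel (𝓡 (n + 1)) f a)

omit [ChartedSpace (𝔼 (n + 1)) M] [IsManifold (𝓡 (n + 1)) ∞ M] in
/-- The source of the change of coordinates between two charts at a common point is a
neighbourhood of the base point (boundaryless Euclidean model). [folklore] -/
theorem extendCoordChange_source_mem_nhds {e e' : OpenPartialHomeomorph M (𝔼 (n + 1))}
    {x : M} (hx : x ∈ e.source) (hx' : x ∈ e'.source) :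
    ((𝓡 (n + 1)).extendCoordChange e e').source ∈ 𝓝 (e x) := by
  have h := (𝓡 (n + 1)).extendCoordChange_source_mem_nhdsWithin' (e := e) (e' := e') hx hx'
  rw [ModelWithCorners.Boundaryless.range_eq_univ, nhdsWithin_univ] at h
  simpa [OpenPartialHomeomorph.extend_coe] using h

omit [IsManifold (𝓡 (n + 1)) ∞ M] in
/-- The derivative at the base point of the change of coordinates between two charts of the
maximal atlas is invertible (boundaryless Euclidean model). [folklore] -/
theorem isInvertible_fderiv_extendCoordChange {e e' : OpenPartialHomeomorph M (𝔼 (n + 1))}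
    (he : e ∈ IsManifold.maximalAtlas (𝓡 (n + 1)) 2 M) (he' : e' ∈ IsManifold.maximalAtlas (𝓡 (n + 1)) 2 M)
    {x : M} (hx : x ∈ e.source) (hx' : x ∈ e'.source) :
    (fderiv ℝ ((𝓡 (n + 1)).extendCoordChange e e') (e x)).IsInvertible := by
  have hnhds := extendCoordChange_source_mem_nhds hx hx'
  have hmem : e x ∈ ((𝓡 (n + 1)).extendCoordChange e e').source := mem_of_mem_nhds hnhds
  have h := (𝓡 (n + 1)).isInvertible_fderivWithin_extendCoordChange (n := 2) (by norm_num) he he' hmem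
  rwa [fderivWithin_of_mem_nhds hnhds] at h

omit [IsManifold (𝓡 (n + 1)) ∞ M] in
/-- The change of coordinates between two charts of the `C²` maximal atlas is `C²` at the base
point (boundaryless Euclidean model). [folklore] -/
theorem contDiffAt_extendCoordChange {e e' : OpenPartialHomeomorph M (𝔼 (n + 1))}
    (he : e ∈ IsManifold.maximalAtlas (𝓡 (n + 1)) 2 M) (he' : e' ∈ IsManifold.maximalAtlas (𝓡 (n + 1)) 2 M)
    {x : M} (hx : x ∈ e.source) (hx' : x ∈ e'.source) :
    ContDiffAt ℝ 2 ((𝓡 (n + 1)).extendCoordChange e e') (e x) := by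
  have h := (𝓡 (n + 1)).contDiffWithinAt_extendCoordChange' (n := 2) he he' hx hx'
  rw [ModelWithCorners.Boundaryless.range_eq_univ, contDiffWithinAt_univ] at h
  simpa [OpenPartialHomeomorph.extend_coe] using h

omit [ChartedSpace (𝔼 (n + 1)) M] [IsManifold (𝓡 (n + 1)) ∞ M] in
/-- Near the base point, a function read in one chart factors through another:
`F ∘ e⁻¹ = (F ∘ e'⁻¹) ∘ τ`, `τ` the change of coordinates `e' ∘ e⁻¹`. [folklore] -/
theorem comp_symm_eventuallyEq_comp_extendCoordChange {e e' : OpenPartialHomeomorph M (𝔼 (n + 1))}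
    (F : M → ℝ) {x : M} (hx : x ∈ e.source) (hx' : x ∈ e'.source) :
    (F ∘ e.symm) =ᶠ[𝓝 (e x)] (F ∘ e'.symm) ∘ (𝓡 (n + 1)).extendCoordChange e e' := by
  have hnhds : e.target ∩ e.symm ⁻¹' e'.source ∈ 𝓝 (e x) := by
    refine inter_mem (e.open_target.mem_nhds (e.map_source hx)) ?_
    exact e.continuousAt_symm (e.map_source hx) |>.preimage_mem_nhds
      (by rw [e.left_inv hx]; exact e'.open_source.mem_nhds hx')
  filter_upwards [hnhds] with z hz
  have hz2 : e.symm z ∈ e'.source := hz.2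
  simp [ModelWithCorners.extendCoordChange, e'.left_inv hz2]

omit [ChartedSpace (𝔼 (n + 1)) M] [IsManifold (𝓡 (n + 1)) ∞ M] in
/-- **The Hessian in a chart, boundaryless Euclidean model**: `hessianInChart (𝓡 (n+1)) e F x`
is the second Fréchet derivative of `F ∘ e⁻¹` at `e x`. [cite: Milnor1963, §2] -/
theorem hessianInChart_apply_eq (e : OpenPartialHomeomorph M (𝔼 (n + 1))) (F : M → ℝ) (x : M)
    (v w : 𝔼 (n + 1)) :
    hessianInChart (𝓡 (n + 1)) e F x v w = fderiv ℝ (fderiv ℝ (F ∘ e.symm)) (e x) v w := by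
  rw [hessianInChart_apply_apply]
  simp [fderivWithin_univ]

variable {h}

/-- Along the level, `f` read in the slice chart is constant on the slice hyperplane near the
base point: `D(f ∘ ψₚ⁻¹)(ψₚ p) ∘ sliceInl = 0`. [cite: LeeSmoothManifolds2013, Prop. 5.38] -/
theorem fderiv_comp_sliceChart_symm_comp_sliceInl (p : RegularLevel h) :
    (fderiv ℝ (f ∘ (h.sliceChartFamily.chart p).symm) (h.sliceChartFamily.chart p p.1)).comp
      (sliceInl n) = 0 := by
  set Ψ := h.sliceChartFamily with hΨ
  -- `f ∘ ψ⁻¹ ∘ sliceInl` is constant `= a` near the base point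
  have hev : (f ∘ (Ψ.chart p).symm) ∘ sliceInl n =ᶠ[𝓝 (extChartAt (𝓡 n) p p)] fun _ => a := by
    filter_upwards [Ψ.levelChart_target_mem_nhds p] with u hu
    have hc := Ψ.coe_levelChart_symm_of_mem hu
    simp only [modelWithCornersSelf_coe_symm, id_eq] at hc
    have hmem : ((Ψ.levelChart p).symm u).val ∈ f ⁻¹' {a} := ((Ψ.levelChart p).symm u).2
    simp only [Function.comp_apply, sliceInl_apply]
    rw [← hc]
    exact hmem
  have hd : fderiv ℝ ((f ∘ (Ψ.chart p).symm) ∘ sliceInl n) (extChartAt (𝓡 n) p p) = 0 := by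
    rw [hev.fderiv_eq]; exact fderiv_const_apply a
  have hpt : sliceInl n (extChartAt (𝓡 n) p p) = Ψ.chart p p.1 := Ψ.sliceInl_extChartAt p
  have hf2 : ContMDiffAt (𝓡 (n + 1)) 𝓘(ℝ, ℝ) 2 f p.1 := (h.contMDiff p.1).of_le (by norm_cast)
  have hdiff : DifferentiableAt ℝ (f ∘ (Ψ.chart p).symm) (sliceInl n (extChartAt (𝓡 n) p p)) := by
    rw [hpt]; exact (Ψ.contDiffAt_comp_chart_symm hf2).differentiableAt (by norm_num)
  rw [fderiv_comp _ hdiff (sliceInl n).differentiableAt, ContinuousLinearMap.fderiv, hpt] at hd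
  exact hd

/-- `f` is not critical at points of the regular level, read in any chart:
`D(f ∘ e⁻¹)(e p) ≠ 0`. [folklore] -/
theorem fderiv_comp_symm_ne_zero (p : RegularLevel h) {e : OpenPartialHomeomorph M (𝔼 (n + 1))}
    (he : e ∈ IsManifold.maximalAtlas (𝓡 (n + 1)) ∞ M) (hpe : p.1 ∈ e.source) :
    fderiv ℝ (f ∘ e.symm) (e p.1) ≠ 0 := by
  have he2 : e ∈ IsManifold.maximalAtlas (𝓡 (n + 1)) 2 M :=
    IsManifold.maximalAtlas_subset_of_le (by norm_cast) he
  have hf2 : ContMDiffAt (𝓡 (n + 1)) 𝓘(ℝ, ℝ) 2 f p.1 := (h.contMDiff p.1).of_le (by norm_cast)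
  intro h0
  have hcrit : IsMCriticalPt (𝓡 (n + 1)) f p.1 := by
    rw [isMCriticalPt_iff_fderiv_comp_extend_symm_eq_zero hf2 he2 hpe]
    simpa [OpenPartialHomeomorph.extend_coe, OpenPartialHomeomorph.extend_coe_symm] using h0
  exact h.not_isMCriticalPt p.2 hcrit

/-- **The tangent hyperplane of the level in a chart.**  For `p` on the regular level and a
chart `e` of the maximal atlas at `p`, the derivative `T` of the coordinate change from the
slice chart `ψₚ` to `e` maps the slice hyperplane `sliceInl(ℝⁿ)` onto
`V = ker D(f ∘ e⁻¹)(e p)` (Lee 2013, Prop. 5.38: the tangent space of a regular level set is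
the kernel of the differential). [cite: LeeSmoothManifolds2013, Prop. 5.38] -/
theorem range_fderiv_extendCoordChange_comp_sliceInl (p : RegularLevel h)
    {e : OpenPartialHomeomorph M (𝔼 (n + 1))} (he : e ∈ IsManifold.maximalAtlas (𝓡 (n + 1)) ∞ M)
    (hpe : p.1 ∈ e.source) :
    LinearMap.range (((fderiv ℝ ((𝓡 (n + 1)).extendCoordChange (h.sliceChartFamily.chart p) e)
        (h.sliceChartFamily.chart p p.1)).comp (sliceInl n) : 𝔼 n →L[ℝ] 𝔼 (n + 1)) :
          𝔼 n →ₗ[ℝ] 𝔼 (n + 1)) =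
      LinearMap.ker (fderiv ℝ (f ∘ e.symm) (e p.1) : 𝔼 (n + 1) →ₗ[ℝ] ℝ) := by
  set Ψ := h.sliceChartFamily with hΨ
  set ψ := Ψ.chart p with hψ
  have hψatlas : ψ ∈ IsManifold.maximalAtlas (𝓡 (n + 1)) ∞ M := Ψ.mem_maximalAtlas p
  have hψ2 : ψ ∈ IsManifold.maximalAtlas (𝓡 (n + 1)) 2 M :=
    IsManifold.maximalAtlas_subset_of_le (by norm_cast) hψatlas
  have he2 : e ∈ IsManifold.maximalAtlas (𝓡 (n + 1)) 2 M :=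
    IsManifold.maximalAtlas_subset_of_le (by norm_cast) he
  have hpψ : p.1 ∈ ψ.source := Ψ.mem_source p
  set T := fderiv ℝ ((𝓡 (n + 1)).extendCoordChange ψ e) (ψ p.1) with hT
  -- `D(f ∘ ψ⁻¹)(ψ p) = D(f ∘ e⁻¹)(e p) ∘ T`
  have hf2 : ContMDiffAt (𝓡 (n + 1)) 𝓘(ℝ, ℝ) 2 f p.1 := (h.contMDiff p.1).of_le (by norm_cast)
  have hev := comp_symm_eventuallyEq_comp_extendCoordChange f hpψ hpe
  have hτ : ContDiffAt ℝ 2 ((𝓡 (n + 1)).extendCoordChange ψ e) (ψ p.1) :=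
    contDiffAt_extendCoordChange hψ2 he2 hpψ hpe
  have hτp : (𝓡 (n + 1)).extendCoordChange ψ e (ψ p.1) = e p.1 := by
    simp [ModelWithCorners.extendCoordChange, ψ.left_inv hpψ]
  have hfe : ContDiffAt ℝ 2 (f ∘ e.symm) (e p.1) := by
    have := contDiffAt_comp_extend_symm hf2 he2 hpe
    simpa [OpenPartialHomeomorph.extend_coe, OpenPartialHomeomorph.extend_coe_symm] using this
  have hchain : fderiv ℝ (f ∘ ψ.symm) (ψ p.1) = (fderiv ℝ (f ∘ e.symm) (e p.1)).comp T := by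
    rw [hev.fderiv_eq, fderiv_comp _ (by rw [hτp]; exact hfe.differentiableAt (by norm_num))
      (hτ.differentiableAt (by norm_num)), hτp]
  -- inclusion `range ⊆ ker`
  have hsub : LinearMap.range ((T.comp (sliceInl n) : 𝔼 n →L[ℝ] 𝔼 (n + 1)) : 𝔼 n →ₗ[ℝ] 𝔼 (n + 1)) ≤
      LinearMap.ker (fderiv ℝ (f ∘ e.symm) (e p.1) : 𝔼 (n + 1) →ₗ[ℝ] ℝ) := by
    rintro _ ⟨u, rfl⟩
    rw [LinearMap.mem_ker]
    have h0 := fderiv_comp_sliceChart_symm_comp_sliceInl p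
    rw [hchain] at h0
    exact congrArg (fun L : 𝔼 n →L[ℝ] ℝ => L u) h0
  -- dimensions: both are `n`
  have hinjT : Injective T := (isInvertible_fderiv_extendCoordChange hψ2 he2 hpψ hpe).injective
  have hinj : Injective ((T.comp (sliceInl n) : 𝔼 n →L[ℝ] 𝔼 (n + 1)) : 𝔼 n →ₗ[ℝ] 𝔼 (n + 1)) :=
    hinjT.comp (sliceInl_injective n)
  have hrange : Module.finrank ℝ (LinearMap.range ((T.comp (sliceInl n) : 𝔼 n →L[ℝ] 𝔼 (n + 1)) :
      𝔼 n →ₗ[ℝ] 𝔼 (n + 1))) = n := by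
    rw [LinearMap.finrank_range_of_inj hinj, finrank_euclideanSpace_fin]
  have hker : Module.finrank ℝ (LinearMap.ker (fderiv ℝ (f ∘ e.symm) (e p.1) : 𝔼 (n + 1) →ₗ[ℝ] ℝ)) = n := by
    set ℓ : 𝔼 (n + 1) →ₗ[ℝ] ℝ := (fderiv ℝ (f ∘ e.symm) (e p.1) : 𝔼 (n + 1) →ₗ[ℝ] ℝ) with hℓ
    have hne : ℓ ≠ 0 := by
      intro h0
      apply fderiv_comp_symm_ne_zero p he hpe
      ext v
      have := congrArg (fun L : 𝔼 (n + 1) →ₗ[ℝ] ℝ => L v) h0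
      simpa [hℓ] using this
    have hsurj : Module.finrank ℝ (LinearMap.range ℓ) = 1 := by
      have hle : Module.finrank ℝ (LinearMap.range ℓ) ≤ 1 := by
        have := Submodule.finrank_le (LinearMap.range ℓ)
        rwa [Module.finrank_self] at this
      have hpos : 0 < Module.finrank ℝ (LinearMap.range ℓ) := by
        rw [Module.finrank_pos_iff_exists_ne_zero]
        obtain ⟨v, hv⟩ : ∃ v, ℓ v ≠ 0 := by
          by_contra hall
          push Not at hall
          exact hne (LinearMap.ext hall)
        exact ⟨⟨ℓ v, v, rfl⟩, fun h0 => hv (congrArg Subtype.val h0)⟩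
      omega
    have hsum := LinearMap.finrank_range_add_finrank_ker ℓ
    rw [hsurj, finrank_euclideanSpace_fin] at hsum
    omega
  exact Submodule.eq_of_le_of_finrank_eq hsub (by rw [hrange, hker])

/-- **Critical points of `F` restricted to a regular level, read in any chart.**  For `F` of
class `C²` at `p ∈ Y = f⁻¹(a)` and a chart `e` of the maximal atlas at `p`, `p` is a critical
point of `F|Y` iff `D(F ∘ e⁻¹)(e p)` vanishes on the hyperplane `V = ker D(f ∘ e⁻¹)(e p)`
(the tangent space of the level read in `e`; Lagrange's condition). [cite: LeeSmoothManifolds2013, Prop. 5.38] -/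
theorem isMCriticalPt_comp_incl_iff_of_chart {F : M → ℝ} (p : RegularLevel h)
    (hF : ContMDiffAt (𝓡 (n + 1)) 𝓘(ℝ, ℝ) 2 F p.1)
    {e : OpenPartialHomeomorph M (𝔼 (n + 1))} (he : e ∈ IsManifold.maximalAtlas (𝓡 (n + 1)) ∞ M)
    (hpe : p.1 ∈ e.source) :
    IsMCriticalPt (𝓡 n) (F ∘ incl h) p ↔
      ∀ v, fderiv ℝ (f ∘ e.symm) (e p.1) v = 0 → fderiv ℝ (F ∘ e.symm) (e p.1) v = 0 := by
  set Ψ := h.sliceChartFamily with hΨ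
  set ψ := Ψ.chart p with hψ
  have hψ2 : ψ ∈ IsManifold.maximalAtlas (𝓡 (n + 1)) 2 M :=
    IsManifold.maximalAtlas_subset_of_le (by norm_cast) (Ψ.mem_maximalAtlas p)
  have he2 : e ∈ IsManifold.maximalAtlas (𝓡 (n + 1)) 2 M :=
    IsManifold.maximalAtlas_subset_of_le (by norm_cast) he
  have hpψ : p.1 ∈ ψ.source := Ψ.mem_source p
  set T := fderiv ℝ ((𝓡 (n + 1)).extendCoordChange ψ e) (ψ p.1) with hT
  have hev := comp_symm_eventuallyEq_comp_extendCoordChange F hpψ hpe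
  have hτ : ContDiffAt ℝ 2 ((𝓡 (n + 1)).extendCoordChange ψ e) (ψ p.1) :=
    contDiffAt_extendCoordChange hψ2 he2 hpψ hpe
  have hτp : (𝓡 (n + 1)).extendCoordChange ψ e (ψ p.1) = e p.1 := by
    simp [ModelWithCorners.extendCoordChange, ψ.left_inv hpψ]
  have hFe : ContDiffAt ℝ 2 (F ∘ e.symm) (e p.1) := by
    have := contDiffAt_comp_extend_symm hF he2 hpe
    simpa [OpenPartialHomeomorph.extend_coe, OpenPartialHomeomorph.extend_coe_symm] using this
  have hchain : fderiv ℝ (F ∘ ψ.symm) (ψ p.1) = (fderiv ℝ (F ∘ e.symm) (e p.1)).comp T := by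
    rw [hev.fderiv_eq, fderiv_comp _ (by rw [hτp]; exact hFe.differentiableAt (by norm_num))
      (hτ.differentiableAt (by norm_num)), hτp]
  have hV := range_fderiv_extendCoordChange_comp_sliceInl p he hpe
  rw [show (IsMCriticalPt (𝓡 n) (F ∘ incl h) p ↔
      (fderiv ℝ (F ∘ ψ.symm) (ψ p.1)).comp (sliceInl n) = 0) from Ψ.isMCriticalPt_comp_val_iff hF,
    hchain, ContinuousLinearMap.comp_assoc]
  constructor
  · intro h0 v hv
    have hv' : v ∈ LinearMap.ker (fderiv ℝ (f ∘ e.symm) (e p.1) : 𝔼 (n + 1) →ₗ[ℝ] ℝ) := hv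
    rw [← hV] at hv'
    obtain ⟨u, rfl⟩ := hv'
    exact congrArg (fun L : 𝔼 n →L[ℝ] ℝ => L u) h0
  · intro hall
    ext u
    have hu : (T.comp (sliceInl n)) u ∈
        LinearMap.ker (fderiv ℝ (f ∘ e.symm) (e p.1) : 𝔼 (n + 1) →ₗ[ℝ] ℝ) := by
      rw [← hV]; exact ⟨u, rfl⟩
    simpa using hall _ hu

/-- An ambient critical point of `F` on the level is a critical point of `F|Y`. [folklore] -/
theorem isMCriticalPt_comp_incl_of_isMCriticalPt {F : M → ℝ} (p : RegularLevel h)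
    (hF : ContMDiffAt (𝓡 (n + 1)) 𝓘(ℝ, ℝ) 2 F p.1) (hp : IsMCriticalPt (𝓡 (n + 1)) F p.1) :
    IsMCriticalPt (𝓡 n) (F ∘ incl h) p := by
  set e := chartAt (𝔼 (n + 1)) p.1 with he
  have heatlas : e ∈ IsManifold.maximalAtlas (𝓡 (n + 1)) ∞ M := IsManifold.chart_mem_maximalAtlas p.1
  have he2 : e ∈ IsManifold.maximalAtlas (𝓡 (n + 1)) 2 M :=
    IsManifold.maximalAtlas_subset_of_le (by norm_cast) heatlas
  have hpe : p.1 ∈ e.source := mem_chart_source _ p.1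
  have h0 : fderiv ℝ (F ∘ e.symm) (e p.1) = 0 := by
    have := (isMCriticalPt_iff_fderiv_comp_extend_symm_eq_zero hF he2 hpe).1 hp
    simpa [OpenPartialHomeomorph.extend_coe, OpenPartialHomeomorph.extend_coe_symm] using this
  rw [isMCriticalPt_comp_incl_iff_of_chart p hF heatlas hpe]
  intro v _
  rw [h0]; rfl

/-- **The Hessian of `F|Y` at an ambient critical point, read in any chart**: if `p ∈ Y` is a
critical point of `F` on `M`, then for a chart `e` of the maximal atlas at `p`,
`Hess(F|Y)_p(v, w) = D²(F ∘ e⁻¹)(e p)(T (v, 0), T (w, 0))`, `T` the derivative at `ψₚ p` of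
the coordinate change from the slice chart `ψₚ` to `e` (second-order chain rule at a
critical point, Milnor 1963, §2: the first-order term vanishes). [cite: Milnor1963, §2] -/
theorem mhessian_comp_incl_apply_of_chart {F : M → ℝ} (p : RegularLevel h)
    (hF : ContMDiffAt (𝓡 (n + 1)) 𝓘(ℝ, ℝ) 2 F p.1) (hp : IsMCriticalPt (𝓡 (n + 1)) F p.1)
    {e : OpenPartialHomeomorph M (𝔼 (n + 1))} (he : e ∈ IsManifold.maximalAtlas (𝓡 (n + 1)) ∞ M)
    (hpe : p.1 ∈ e.source) (v w : 𝔼 n) :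
    mhessian (𝓡 n) (F ∘ incl h) p v w =
      fderiv ℝ (fderiv ℝ (F ∘ e.symm)) (e p.1)
        (fderiv ℝ ((𝓡 (n + 1)).extendCoordChange (h.sliceChartFamily.chart p) e)
          (h.sliceChartFamily.chart p p.1) (sliceInl n v))
        (fderiv ℝ ((𝓡 (n + 1)).extendCoordChange (h.sliceChartFamily.chart p) e)
          (h.sliceChartFamily.chart p p.1) (sliceInl n w)) := by
  set Ψ := h.sliceChartFamily with hΨ
  set ψ := Ψ.chart p with hψ
  have hψ2 : ψ ∈ IsManifold.maximalAtlas (𝓡 (n + 1)) 2 M :=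
    IsManifold.maximalAtlas_subset_of_le (by norm_cast) (Ψ.mem_maximalAtlas p)
  have he2 : e ∈ IsManifold.maximalAtlas (𝓡 (n + 1)) 2 M :=
    IsManifold.maximalAtlas_subset_of_le (by norm_cast) he
  have hpψ : p.1 ∈ ψ.source := Ψ.mem_source p
  have hev := comp_symm_eventuallyEq_comp_extendCoordChange F hpψ hpe
  have hτ : ContDiffAt ℝ 2 ((𝓡 (n + 1)).extendCoordChange ψ e) (ψ p.1) :=
    contDiffAt_extendCoordChange hψ2 he2 hpψ hpe
  have hτp : (𝓡 (n + 1)).extendCoordChange ψ e (ψ p.1) = e p.1 := by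
    simp [ModelWithCorners.extendCoordChange, ψ.left_inv hpψ]
  have hFe : ContDiffAt ℝ 2 (F ∘ e.symm) (e p.1) := by
    have := contDiffAt_comp_extend_symm hF he2 hpe
    simpa [OpenPartialHomeomorph.extend_coe, OpenPartialHomeomorph.extend_coe_symm] using this
  have h0 : fderiv ℝ (F ∘ e.symm) (e p.1) = 0 := by
    have := (isMCriticalPt_iff_fderiv_comp_extend_symm_eq_zero hF he2 hpe).1 hp
    simpa [OpenPartialHomeomorph.extend_coe, OpenPartialHomeomorph.extend_coe_symm] using this
  rw [show mhessian (𝓡 n) (F ∘ incl h) p v w =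
      fderiv ℝ (fderiv ℝ (F ∘ ψ.symm)) (ψ p.1) (sliceInl n v) (sliceInl n w) from
    Ψ.mhessian_comp_val_apply hF v w, hev.fderiv.fderiv_eq]
  rw [← hτp] at hFe h0
  rw [fderiv_fderiv_comp_apply_of_fderiv_eq_zero hFe hτ h0, hτp]

/-- **Morse data of `F|Y` at an ambient critical point, through the tangent hyperplane.**  Let
`p ∈ Y = f⁻¹(a)` be a critical point of `F` on `M`, `e` a chart of the maximal atlas at `p`,
`B = D²(F ∘ e⁻¹)(e p)` (`hessianInChart`) and `V = ker D(f ∘ e⁻¹)(e p)`.  Then there is a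
linear isomorphism `L : ℝⁿ ≃ V` with `Hess(F|Y)_p(v, w) = B(L v, L w)`: the Hessian of `F|Y`
is congruent to the restriction of `B` to `V`.  Hence (`nondegenerate_mhessian_comp_incl_iff`,
`morseIndex_comp_incl_eq`) nondegeneracy and the Morse index of `F|Y` at `p` are those of
`B|_V` (Milnor 1963, §2; Sylvester). [cite: Milnor1963, §2] -/
theorem exists_linearEquiv_mhessian_comp_incl_eq {F : M → ℝ} (p : RegularLevel h)
    (hF : ContMDiffAt (𝓡 (n + 1)) 𝓘(ℝ, ℝ) 2 F p.1) (hp : IsMCriticalPt (𝓡 (n + 1)) F p.1)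
    {e : OpenPartialHomeomorph M (𝔼 (n + 1))} (he : e ∈ IsManifold.maximalAtlas (𝓡 (n + 1)) ∞ M)
    (hpe : p.1 ∈ e.source) :
    ∃ L : 𝔼 n ≃ₗ[ℝ] LinearMap.ker (fderiv ℝ (f ∘ e.symm) (e p.1) : 𝔼 (n + 1) →ₗ[ℝ] ℝ),
      ∀ v w, mhessian (𝓡 n) (F ∘ incl h) p v w =
        (hessianInChart (𝓡 (n + 1)) e F p.1).restrict
          (LinearMap.ker (fderiv ℝ (f ∘ e.symm) (e p.1) : 𝔼 (n + 1) →ₗ[ℝ] ℝ)) (L v) (L w) := by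
  set Ψ := h.sliceChartFamily with hΨ
  set ψ := Ψ.chart p with hψ
  have hψ2 : ψ ∈ IsManifold.maximalAtlas (𝓡 (n + 1)) 2 M :=
    IsManifold.maximalAtlas_subset_of_le (by norm_cast) (Ψ.mem_maximalAtlas p)
  have he2 : e ∈ IsManifold.maximalAtlas (𝓡 (n + 1)) 2 M :=
    IsManifold.maximalAtlas_subset_of_le (by norm_cast) he
  have hpψ : p.1 ∈ ψ.source := Ψ.mem_source p
  set T := fderiv ℝ ((𝓡 (n + 1)).extendCoordChange ψ e) (ψ p.1) with hT
  set V := LinearMap.ker (fderiv ℝ (f ∘ e.symm) (e p.1) : 𝔼 (n + 1) →ₗ[ℝ] ℝ) with hV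
  set A : 𝔼 n →ₗ[ℝ] 𝔼 (n + 1) := ((T.comp (sliceInl n) : 𝔼 n →L[ℝ] 𝔼 (n + 1)) : 𝔼 n →ₗ[ℝ] 𝔼 (n + 1))
    with hA
  have hrange : LinearMap.range A = V := range_fderiv_extendCoordChange_comp_sliceInl p he hpe
  have hinj : Injective A :=
    (isInvertible_fderiv_extendCoordChange hψ2 he2 hpψ hpe).injective.comp (sliceInl_injective n)
  -- `A` corestricted to `V`, a linear isomorphism
  set A' : 𝔼 n →ₗ[ℝ] V := A.codRestrict V (fun u => by rw [← hrange]; exact ⟨u, rfl⟩) with hA'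
  have hinj' : Injective A' := by
    intro u u' huu
    apply hinj
    have := congrArg Subtype.val huu
    exact this
  have hsurj' : Surjective A' := by
    rintro ⟨y, hy⟩
    rw [← hrange] at hy
    obtain ⟨u, rfl⟩ := hy
    exact ⟨u, rfl⟩
  refine ⟨LinearEquiv.ofBijective A' ⟨hinj', hsurj'⟩, fun v w => ?_⟩
  rw [mhessian_comp_incl_apply_of_chart p hF hp he hpe v w]
  change _ = hessianInChart (𝓡 (n + 1)) e F p.1 (T (sliceInl n v)) (T (sliceInl n w))
  rw [hessianInChart_apply_eq]

/-- **Nondegeneracy of `F|Y` at an ambient critical point** is that of `D²(F ∘ e⁻¹)(e p)`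
restricted to `V = ker D(f ∘ e⁻¹)(e p)`. [cite: Milnor1963, §2] -/
theorem nondegenerate_mhessian_comp_incl_iff {F : M → ℝ} (p : RegularLevel h)
    (hF : ContMDiffAt (𝓡 (n + 1)) 𝓘(ℝ, ℝ) 2 F p.1) (hp : IsMCriticalPt (𝓡 (n + 1)) F p.1)
    {e : OpenPartialHomeomorph M (𝔼 (n + 1))} (he : e ∈ IsManifold.maximalAtlas (𝓡 (n + 1)) ∞ M)
    (hpe : p.1 ∈ e.source) :
    (mhessian (𝓡 n) (F ∘ incl h) p).Nondegenerate ↔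
      ((hessianInChart (𝓡 (n + 1)) e F p.1).restrict
        (LinearMap.ker (fderiv ℝ (f ∘ e.symm) (e p.1) : 𝔼 (n + 1) →ₗ[ℝ] ℝ))).Nondegenerate := by
  obtain ⟨L, hL⟩ := exists_linearEquiv_mhessian_comp_incl_eq p hF hp he hpe
  exact nondegenerate_iff_of_forall_apply_eq L hL

/-- **The Morse index of `F|Y` at an ambient critical point** is the negative index of inertia
of `D²(F ∘ e⁻¹)(e p)` restricted to `V = ker D(f ∘ e⁻¹)(e p)` (Sylvester's law; Milnor 1963,
§2).  For the Heegaard function of Gay–Kirby's Lemma 14 near the attaching link this turns the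
explicit `4`-dimensional Hessians `diag(0, ±ε₀/η, 2κ, 2κ)` on `V = {dx₀ = 0}` into the indices
`0` and `1` of `p_j`, `q_j`. [cite: Milnor1963, §2] [cite: GayKirby2016, §4, Lemma 14] -/
theorem morseIndex_comp_incl_eq {F : M → ℝ} (p : RegularLevel h)
    (hF : ContMDiffAt (𝓡 (n + 1)) 𝓘(ℝ, ℝ) 2 F p.1) (hp : IsMCriticalPt (𝓡 (n + 1)) F p.1)
    {e : OpenPartialHomeomorph M (𝔼 (n + 1))} (he : e ∈ IsManifold.maximalAtlas (𝓡 (n + 1)) ∞ M)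
    (hpe : p.1 ∈ e.source) :
    morseIndex (𝓡 n) (F ∘ incl h) p =
      sigNeg ((hessianInChart (𝓡 (n + 1)) e F p.1).restrict
        (LinearMap.ker (fderiv ℝ (f ∘ e.symm) (e p.1) : 𝔼 (n + 1) →ₗ[ℝ] ℝ))).toQuadraticMap := by
  obtain ⟨L, hL⟩ := exists_linearEquiv_mhessian_comp_incl_eq p hF hp he hpe
  unfold morseIndex
  exact sigNeg_eq_of_forall_apply_eq L hL

end RegularLevel


end Literature.Topology.FourManifolds

end
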